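import Summits.CriticalPhenomena.PercolationContinuityZ3.Theorems.PercNearOneGluingNoHeavyQuantTwoBigChain
import HarnessLib

/-!
# QUANT lane R8, Conjecture DIB\* — the two-big certificate, cell `LL/C3, block B1`

builds on p205010 (kernel theorem, internal audit signed; external expert review pending)

Support file (`--supports stmt-CriticalPhenomena-4575`), QUANT lane census-1 (gen 17); memo
`run/shared/lean/prim/quant/prim-quant-census-1/TWOBIG-G17.md`.  Theorems only, no definitions, no sorries, standard axioms.
Coordinates `y = 1 − x`, `uᵢ = αᵢφᵢ`, `vᵢ = αᵢ(1 − φᵢ)` (`αᵢ = bᵢ/j`, `φᵢ` = credit rate of big `i`); the three `tbcBlock_*` lemmas are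
LP-found Handelman certificates (products of the cell's defining inequalities, replayed by `linarith`) of a separable budget split
`c₁ + c₂ + c₀ = (1−y)α₁α₂ − P₁P₂`, `cₖ·Dₖ ≤ Bₖ·Nₖ`; `tbcCell_*` combines them into the reduced inequality of the cell
(items in product form).  [this work]; the gluing rows served [cite: KozmaNitzan2024, Conjecture 3 (p. 15)].
-/

namespace Summit.CriticalPhenomena.PercolationContinuityZ3.Theorems

namespace Quant

namespace IndepBlob

set_option maxHeartbeats 1000000 in
set_option maxRecDepth 8192 in
/-- Two-big cell `LL/C3`, block 1: Handelman support (134 products; kit LP; split polynomial rounded to denominators ≤ 256). [this work] -/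
theorem tbcBlock_LL_C3_1 (y u₁ v₁ u₂ v₂ : ℝ) (_hy : 0 ≤ y) (_hhy : 0 ≤ 1 / 2 - y) (_hu1 : 0 ≤ u₁) (_hv1 : 0 ≤ v₁) (_hu2 : 0 ≤ u₂) (_hv2 : 0 ≤ v₂)
    (_ha1 : 0 ≤ 1 - u₁ - v₁) (_hb1 : 0 ≤ u₁ + v₁ - 1 / 2) (_ha2 : 0 ≤ 1 - u₂ - v₂) (_hb2 : 0 ≤ u₂ + v₂ - 1 / 2) (_ht1 : 0 ≤ (1 - y) * v₁ - u₁ * y)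
    (_ht2 : 0 ≤ (1 - y) * v₂ - u₂ * y) (_hr1 : 0 ≤ (2 - y) * (1 - u₁ - v₁) - (2 - u₁ - u₂)) :
    (5 / 128 + 25 / 64 * y - 17 / 64 * u₁ - 71 / 128 * v₁ + 13 / 32 * u₂ - 11 / 32 * v₂ + 219 / 256 * y ^ 2 - 23 / 16 * y * u₁ - 337 / 256 * y * v₁ -
          155 / 256 * y * u₂ - 143 / 128 * y * v₂ + 115 / 256 * u₁ ^ 2 + 107 / 128 * u₁ * v₁ + 13 / 32 * u₁ * u₂ + 453 / 256 * u₁ * v₂ + 61 / 128 * v₁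
          ^ 2 + 201 / 256 * v₁ * u₂ + 121 / 64 * v₁ * v₂ - 105 / 256 * u₂ ^ 2 - 27 / 256 * u₂ * v₂ + 17 / 256 * v₂ ^ 2) * ((2 - u₁ - u₂) - (1 - y) *
          (1 - u₁ - v₁))
      ≤ (((u₁ + v₁) * (1 - y) ^ 2 + y * u₁) * ((u₂ + v₂) * (2 - y) - u₂)) * ((1 - y) * (1 + v₁ - u₂)) := by
  linarith [
    mul_nonneg (mul_nonneg (mul_nonneg (mul_nonneg _hy _hy) _hy) _ha1) _hr1, mul_nonneg (mul_nonneg (mul_nonneg _hy _hy) _hy) _hb1,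
    mul_nonneg (mul_nonneg (mul_nonneg (mul_nonneg (mul_nonneg _hy _hy) _hhy) _hu2) _hu2) _hr1,
    mul_nonneg (mul_nonneg (mul_nonneg _hy _hy) _hhy) _ha1, mul_nonneg (mul_nonneg (mul_nonneg _hy _hy) _ha1) _hb1,
    mul_nonneg (mul_nonneg (mul_nonneg (mul_nonneg _hy _hy) _ha1) _ha2) _hr1, mul_nonneg (mul_nonneg (mul_nonneg _hy _hy) _ha1) _hb2,
    mul_nonneg (mul_nonneg (mul_nonneg _hy _hy) _ha1) _hr1, mul_nonneg (mul_nonneg (mul_nonneg _hy _hy) _hb1) _ha2,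
    mul_nonneg (mul_nonneg (mul_nonneg (mul_nonneg _hy _hy) _ha2) _ha2) _hr1, mul_nonneg (mul_nonneg (mul_nonneg _hy _hy) _ha2) _hr1,
    mul_nonneg (mul_nonneg (mul_nonneg (mul_nonneg _hy _hhy) _hhy) _hu1) _hb2,
    mul_nonneg (mul_nonneg (mul_nonneg (mul_nonneg (mul_nonneg _hy _hhy) _hhy) _hv2) _hv2) _hr1,
    mul_nonneg (mul_nonneg (mul_nonneg (mul_nonneg _hy _hhy) _hhy) _hv2) _hr1,
    mul_nonneg (mul_nonneg (mul_nonneg (mul_nonneg _hy _hhy) _hhy) _hb1) _hb1,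
    mul_nonneg (mul_nonneg (mul_nonneg (mul_nonneg _hy _hhy) _hu1) _hu2) _hu2,
    mul_nonneg (mul_nonneg (mul_nonneg (mul_nonneg _hy _hhy) _hu1) _hu2) _hb2,
    mul_nonneg (mul_nonneg (mul_nonneg (mul_nonneg _hy _hhy) _hu1) _ht1) _ht2,
    mul_nonneg (mul_nonneg (mul_nonneg (mul_nonneg _hy _hhy) _hv1) _hb2) _hr1,
    mul_nonneg (mul_nonneg (mul_nonneg (mul_nonneg _hy _hhy) _hv1) _ht2) _hr1,
    mul_nonneg (mul_nonneg (mul_nonneg (mul_nonneg _hy _hhy) _hu2) _hu2) _ht2,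
    mul_nonneg (mul_nonneg (mul_nonneg (mul_nonneg _hy _hhy) _hu2) _hb1) _ht2, mul_nonneg (mul_nonneg _hy _hhy) _ha2,
    mul_nonneg (mul_nonneg (mul_nonneg _hy _hhy) _ha2) _ha2, mul_nonneg (mul_nonneg (mul_nonneg (mul_nonneg _hy _hhy) _ha2) _hr1) _hr1,
    mul_nonneg (mul_nonneg (mul_nonneg _hy _hhy) _hb2) _hr1, mul_nonneg (mul_nonneg (mul_nonneg _hy _hhy) _ht2) _hr1,
    mul_nonneg (mul_nonneg (mul_nonneg _hy _hv1) _ht2) _hr1, mul_nonneg (mul_nonneg (mul_nonneg _hy _hu2) _hu2) _ht2,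
    mul_nonneg (mul_nonneg (mul_nonneg _hy _hu2) _hv2) _hr1, mul_nonneg (mul_nonneg (mul_nonneg _hy _hv2) _hv2) _hv2,
    mul_nonneg (mul_nonneg (mul_nonneg _hy _hv2) _hv2) _ha1, mul_nonneg (mul_nonneg (mul_nonneg _hy _hv2) _hv2) _ht2,
    mul_nonneg (mul_nonneg (mul_nonneg _hy _ha1) _ha1) _hb1, mul_nonneg (mul_nonneg (mul_nonneg _hy _ha1) _ha1) _hb2,
    mul_nonneg (mul_nonneg (mul_nonneg _hy _ha1) _ha1) _ht2, mul_nonneg (mul_nonneg (mul_nonneg _hy _ha1) _ha1) _hr1,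
    mul_nonneg (mul_nonneg (mul_nonneg _hy _ha1) _hb1) _ha2, mul_nonneg (mul_nonneg _hy _hb1) _ha2,
    mul_nonneg (mul_nonneg (mul_nonneg _hy _hb1) _ha2) _ha2, mul_nonneg (mul_nonneg (mul_nonneg _hy _hb1) _ht2) _hr1, mul_nonneg _hy _hr1,
    mul_nonneg (mul_nonneg (mul_nonneg (mul_nonneg (mul_nonneg _hhy _hhy) _hhy) _hhy) _hu1) _ha2,
    mul_nonneg (mul_nonneg (mul_nonneg (mul_nonneg _hhy _hhy) _hhy) _hhy) _hv1,
    mul_nonneg (mul_nonneg (mul_nonneg (mul_nonneg (mul_nonneg _hhy _hhy) _hhy) _hhy) _hu2) _ha2,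
    mul_nonneg (mul_nonneg (mul_nonneg (mul_nonneg _hhy _hhy) _hhy) _hhy) _hv2,
    mul_nonneg (mul_nonneg (mul_nonneg (mul_nonneg (mul_nonneg _hhy _hhy) _hhy) _hhy) _hb1) _ha2,
    mul_nonneg (mul_nonneg (mul_nonneg (mul_nonneg (mul_nonneg _hhy _hhy) _hhy) _hhy) _ha2) _hb2,
    mul_nonneg (mul_nonneg (mul_nonneg (mul_nonneg (mul_nonneg _hhy _hhy) _hhy) _hu1) _ha2) _ht1,
    mul_nonneg (mul_nonneg (mul_nonneg (mul_nonneg _hhy _hhy) _hhy) _hv1) _hv2,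
    mul_nonneg (mul_nonneg (mul_nonneg (mul_nonneg _hhy _hhy) _hhy) _hv1) _ht1,
    mul_nonneg (mul_nonneg (mul_nonneg (mul_nonneg _hhy _hhy) _hhy) _hv1) _ht2,
    mul_nonneg (mul_nonneg (mul_nonneg (mul_nonneg (mul_nonneg _hhy _hhy) _hhy) _hu2) _hu2) _ha2,
    mul_nonneg (mul_nonneg (mul_nonneg (mul_nonneg (mul_nonneg _hhy _hhy) _hhy) _hu2) _ha1) _ht2,
    mul_nonneg (mul_nonneg (mul_nonneg (mul_nonneg (mul_nonneg _hhy _hhy) _hhy) _hu2) _hb1) _ha2,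
    mul_nonneg (mul_nonneg (mul_nonneg (mul_nonneg (mul_nonneg _hhy _hhy) _hhy) _hu2) _ha2) _hb2,
    mul_nonneg (mul_nonneg (mul_nonneg (mul_nonneg (mul_nonneg _hhy _hhy) _hhy) _hu2) _ha2) _ht1,
    mul_nonneg (mul_nonneg (mul_nonneg _hhy _hhy) _hhy) _hv2,
    mul_nonneg (mul_nonneg (mul_nonneg (mul_nonneg (mul_nonneg _hhy _hhy) _hhy) _hv2) _hv2) _hb1,
    mul_nonneg (mul_nonneg (mul_nonneg (mul_nonneg _hhy _hhy) _hhy) _hv2) _ht2,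
    mul_nonneg (mul_nonneg (mul_nonneg (mul_nonneg (mul_nonneg _hhy _hhy) _hhy) _ha1) _hb1) _ht2,
    mul_nonneg (mul_nonneg (mul_nonneg (mul_nonneg (mul_nonneg _hhy _hhy) _hhy) _hb1) _ha2) _hb2,
    mul_nonneg (mul_nonneg (mul_nonneg (mul_nonneg (mul_nonneg _hhy _hhy) _hhy) _ha2) _ha2) _hr1,
    mul_nonneg (mul_nonneg (mul_nonneg (mul_nonneg (mul_nonneg _hhy _hhy) _hhy) _ha2) _hb2) _ht1,
    mul_nonneg (mul_nonneg (mul_nonneg (mul_nonneg _hhy _hhy) _hhy) _ha2) _ht2, mul_nonneg (mul_nonneg (mul_nonneg _hhy _hhy) _hhy) _ht2,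
    mul_nonneg (mul_nonneg (mul_nonneg (mul_nonneg _hhy _hhy) _hu1) _hu2) _ha2,
    mul_nonneg (mul_nonneg (mul_nonneg (mul_nonneg _hhy _hhy) _hu1) _hv2) _hv2,
    mul_nonneg (mul_nonneg (mul_nonneg (mul_nonneg _hhy _hhy) _hu1) _ha1) _ht2,
    mul_nonneg (mul_nonneg (mul_nonneg (mul_nonneg _hhy _hhy) _hu1) _hb1) _ha2,
    mul_nonneg (mul_nonneg (mul_nonneg (mul_nonneg _hhy _hhy) _hu1) _ha2) _hb2,
    mul_nonneg (mul_nonneg (mul_nonneg (mul_nonneg _hhy _hhy) _hv1) _hv2) _ht1, mul_nonneg (mul_nonneg (mul_nonneg _hhy _hhy) _hv1) _hb1,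
    mul_nonneg (mul_nonneg (mul_nonneg (mul_nonneg _hhy _hhy) _hv1) _hb2) _ht1, mul_nonneg (mul_nonneg (mul_nonneg _hhy _hhy) _hv1) _ht1,
    mul_nonneg (mul_nonneg (mul_nonneg (mul_nonneg _hhy _hhy) _hv1) _ht1) _ht2, mul_nonneg (mul_nonneg (mul_nonneg _hhy _hhy) _hv1) _ht2,
    mul_nonneg (mul_nonneg (mul_nonneg (mul_nonneg _hhy _hhy) _hu2) _hu2) _ha2,
    mul_nonneg (mul_nonneg (mul_nonneg (mul_nonneg _hhy _hhy) _hu2) _hv2) _hv2,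
    mul_nonneg (mul_nonneg (mul_nonneg (mul_nonneg _hhy _hhy) _hu2) _ha1) _ht2,
    mul_nonneg (mul_nonneg (mul_nonneg (mul_nonneg _hhy _hhy) _hu2) _hb1) _ha2,
    mul_nonneg (mul_nonneg (mul_nonneg (mul_nonneg _hhy _hhy) _hu2) _ha2) _hb2,
    mul_nonneg (mul_nonneg (mul_nonneg (mul_nonneg _hhy _hhy) _hv2) _hv2) _hb1, mul_nonneg (mul_nonneg (mul_nonneg _hhy _hhy) _hv2) _hb1,
    mul_nonneg (mul_nonneg (mul_nonneg _hhy _hhy) _hv2) _ht1, mul_nonneg (mul_nonneg (mul_nonneg (mul_nonneg _hhy _hhy) _hv2) _ht1) _ht2,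
    mul_nonneg (mul_nonneg (mul_nonneg (mul_nonneg _hhy _hhy) _ha1) _hb1) _ht2,
    mul_nonneg (mul_nonneg (mul_nonneg (mul_nonneg _hhy _hhy) _ha2) _ha2) _hr1, mul_nonneg (mul_nonneg _hhy _hhy) _ht1,
    mul_nonneg (mul_nonneg (mul_nonneg _hhy _hhy) _ht1) _ht1, mul_nonneg (mul_nonneg _hhy _hhy) _ht2,
    mul_nonneg (mul_nonneg (mul_nonneg _hhy _hu1) _hv1) _hb2, mul_nonneg (mul_nonneg (mul_nonneg _hhy _hu1) _hv2) _ht2,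
    mul_nonneg (mul_nonneg (mul_nonneg _hhy _hu1) _ha1) _ht1, mul_nonneg (mul_nonneg (mul_nonneg _hhy _hu1) _ha1) _ht2,
    mul_nonneg (mul_nonneg (mul_nonneg _hhy _hv1) _hu2) _hu2, mul_nonneg (mul_nonneg (mul_nonneg _hhy _hv1) _hu2) _ht1,
    mul_nonneg (mul_nonneg (mul_nonneg _hhy _hv1) _hb1) _hb2, mul_nonneg (mul_nonneg (mul_nonneg _hhy _hv1) _ht1) _ht2,
    mul_nonneg (mul_nonneg (mul_nonneg _hhy _hb1) _ha2) _hr1, mul_nonneg _hhy _ht1, mul_nonneg (mul_nonneg (mul_nonneg _hhy _ht2) _hr1) _hr1,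
    mul_nonneg (mul_nonneg _hu1 _hv1) _ht1, mul_nonneg (mul_nonneg _hu1 _hv1) _ht2, mul_nonneg (mul_nonneg _hu1 _hv2) _hb1,
    mul_nonneg (mul_nonneg _hu1 _hv2) _ht1, mul_nonneg (mul_nonneg _hu1 _ha1) _ht1, mul_nonneg (mul_nonneg _hu1 _ha2) _hb2, mul_nonneg _hu1 _ht1,
    mul_nonneg (mul_nonneg _hv1 _hu2) _hu2, mul_nonneg (mul_nonneg _hv1 _hu2) _hb1, mul_nonneg (mul_nonneg _hv1 _hv2) _hr1,
    mul_nonneg (mul_nonneg _hv1 _hb1) _hr1, mul_nonneg (mul_nonneg _hv1 _hb2) _hr1, mul_nonneg (mul_nonneg _hv1 _ht1) _hr1,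
    mul_nonneg (mul_nonneg _hu2 _hv2) _hb1, mul_nonneg (mul_nonneg _hu2 _hv2) _hr1, mul_nonneg (mul_nonneg _hu2 _hb1) _ha2,
    mul_nonneg (mul_nonneg _hu2 _ha2) _hr1, mul_nonneg (mul_nonneg _hv2 _hv2) _ha2, mul_nonneg (mul_nonneg _hv2 _ha1) _ha1,
    mul_nonneg (mul_nonneg _hv2 _ha1) _ha2, mul_nonneg (mul_nonneg _hv2 _hb1) _hb1, mul_nonneg (mul_nonneg _hv2 _hb1) _hr1, mul_nonneg _hv2 _ha2,
    mul_nonneg (mul_nonneg _hv2 _hb2) _hr1, mul_nonneg (mul_nonneg _hv2 _ht2) _ht2, mul_nonneg (mul_nonneg _ha1 _hb1) _ha2,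
    mul_nonneg (mul_nonneg _ha1 _hb1) _ht1, mul_nonneg _ha2 _hb2, mul_nonneg _ha2 _ht2, mul_nonneg (mul_nonneg _ha2 _hr1) _hr1, mul_nonneg _ht2 _ht2,
    mul_nonneg (mul_nonneg _ht2 _hr1) _hr1]

end IndepBlob

end Quant

end Summit.CriticalPhenomena.PercolationContinuityZ3.Theorems
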